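import Mathlib
import HarnessLib
import Summits.AnomalousDissipation.AnomalousDissipation.Theses.ResponseTelescope
import Summits.AnomalousDissipation.AnomalousDissipation.Theorems.DenseLoudDesignerForces.Negative.Scaling
import Literature.Analysis.FluidPDE.ClassicalOpenStripEnergy

/-!
# STRATEGY CENSUS (typed companion) — crux `ResponseTelescope.HalvingCeiling` (stmt-AnomalousDissipation-2028)

Crux-strategist `planner-cstrat-stmt-AnomalousDissipation-2028-s1-0`, 2026-08-17. Kernel-checked facts used by
`Cruxes/HalvingCeiling/STRATEGY-CENSUS.md` (§-numbers match the `Lean §n` references there). No `sorry`.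

* §1 SCOPE ALGEBRA. The scope `{Ē > 0, β = Ī/Ē^{3/2} ≥ 1/20, r² = νĪ/Ē² ≤ (1/250)²}` forces the Taylor-wavenumber
  floor `Ī ≥ (25/2)²·νĒ` (`taylor_floor_of_scope`); the pinned clause forces the tolerance `C r^θ ≤ 1/40`
  (`tolerance_le_of_clause`). Consequence (§2): NO field whose every time slice saturates the first-shell Poincaré
  equality `‖∇v‖² = 4π²‖v‖²` (laminar/Kolmogorov/ABC/Beltrami single-shell states, and their Galilean/swept variants
  `m + v`, which only add energy) is ever in scope (`not_scope_of_poincare_saturating`,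
  `gradNormSq_eq_of_firstShell`) — negation has no closed-form test orbit.
* §3 VACUITY. Empty scope for every first-shell force ⇒ `HalvingCeiling` (with `C = 0`): the 2-D transfer
  (Marchioro / Alexakis–Doering) proves the crux only in this degenerate way (`halvingCeiling_of_emptyScope`).
* §4 TRANSFER IN STATEMENT SPACE (Reynolds similarity). `HalvingCeiling ↔ GrashofCeiling`: at UNIT viscosity, every
  in-scope periodic orbit of `NS₁(s•f)` has a partner periodic orbit of `NS₁((4s)•f)` with budgets `×(4, 8)` up to the
  same relative tolerance — halving the viscosity IS quadrupling the force (`halvingCeiling_iff_grashofCeiling`), by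
  the landed parabolic rescaling `Theorems/DenseLoudDesignerForces/Negative/Scaling.lean`.
* §5 STRENGTHEN. `SteadyHalvingCeiling` (steady partners) ⇒ crux (`halvingCeiling_of_steady`); the Grashof-LOCAL
  log-Lipschitz response `LocalLogLipschitzResponse` is typed (signature; it is STRONGER than the crux at `λ = 4`,
  `grashofCeiling_of_logLipschitz_four`).
-/

set_option linter.dupNamespace false
set_option linter.unusedVariables false

noncomputable section

namespace Summit.AnomalousDissipation.AnomalousDissipation.Cruxes.HalvingCeiling.Census

open MeasureTheory Set Filter Topology Function
open scoped InnerProductSpace BigOperators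
open Literature.Analysis.FunctionSpaces Literature.Analysis.FunctionSpaces.Torus
open Literature.Analysis.FluidPDE
open Summit.AnomalousDissipation.AnomalousDissipation.Theses.ResponseTelescope
open Summit.AnomalousDissipation.AnomalousDissipation.Theorems.DenseLoudDesignerForces.Negative

/-- The physical flat unit torus `T³` (local notation). -/
local notation "𝕋³" => UnitAddTorus (Fin 3)
/-- Velocity values (local notation). -/
local notation "E³" => EuclideanSpace ℝ (Fin 3)

/-! ## §1 Scope algebra -/

/-- TAYLOR-WAVENUMBER FLOOR of the scope: `β ≥ 1/20` and `r ≤ 1/250` force `Ī ≥ (25/2)² νĒ`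
(`k_T² = ⟨‖∇u‖²⟩/⟨‖u‖²⟩ = Ī/(νĒ) = (β/r)² ≥ 156.25 > 4π²`). -/
theorem taylor_floor_of_scope {ν E I : ℝ} (hν : 0 < ν) (hE : 0 < E)
    (hβ : (1 / 20 : ℝ) * (E * Real.sqrt E) ≤ I) (hr : ν * I ≤ (1 / 250 : ℝ) ^ 2 * E ^ 2) :
    (25 / 2 : ℝ) ^ 2 * (ν * E) ≤ I := by
  have hsE : 0 < Real.sqrt E := Real.sqrt_pos.2 hE
  have hI : 0 < I := lt_of_lt_of_le (by positivity) hβ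
  have hsq : Real.sqrt E ^ 2 = E := Real.sq_sqrt hE.le
  -- `E³ ≤ 400 I²`
  have h1 : E * Real.sqrt E ≤ 20 * I := by linarith
  have h2 : (E * Real.sqrt E) ^ 2 ≤ (20 * I) ^ 2 := pow_le_pow_left₀ (by positivity) h1 2
  have h3 : E ^ 3 ≤ 400 * I ^ 2 := by nlinarith [h2, hsq]
  -- `ν E · I ≤ E³/250² ≤ 400 I²/250²`
  have h4 : ν * E * I ≤ (1 / 250 : ℝ) ^ 2 * E ^ 3 := by nlinarith [hr, hE]
  have h5 : ν * E * I ≤ (1 / 250 : ℝ) ^ 2 * (400 * I ^ 2) := h4.trans (by nlinarith [h3])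
  have h6 : ν * E ≤ (1 / 250 : ℝ) ^ 2 * 400 * I := by
    have : ν * E * I ≤ ((1 / 250 : ℝ) ^ 2 * 400 * I) * I := by nlinarith [h5]
    exact le_of_mul_le_mul_right this hI
  nlinarith [h6]

/-- The pinned clause caps the one-step tolerance: `C (1/250)^θ ≤ (1 − (3/4)^θ)/10 ≤ 1/40`. -/
theorem clause_le_one_div_forty {C θ : ℝ} (hθ : 0 < θ) (hθ1 : θ ≤ 1)
    (hcl : C * (1 / 250 : ℝ) ^ θ ≤ (1 - (3 / 4 : ℝ) ^ θ) / 10) :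
    C * (1 / 250 : ℝ) ^ θ ≤ 1 / 40 := by
  have hq : (3 / 4 : ℝ) ≤ (3 / 4 : ℝ) ^ θ := by
    have := Real.rpow_le_rpow_of_exponent_ge (by norm_num : (0 : ℝ) < 3 / 4) (by norm_num) hθ1
    simpa using this
  linarith

/-- In scope, the modulus `ρ = (νĪ/Ē²)^{θ/2}` is at most `(1/250)^θ`, so the relative tolerance `Cρ ≤ 1/40`. -/
theorem tolerance_le_of_clause {C θ ν E I : ℝ} (hC : 0 ≤ C) (hθ : 0 < θ) (hθ1 : θ ≤ 1)
    (hcl : C * (1 / 250 : ℝ) ^ θ ≤ (1 - (3 / 4 : ℝ) ^ θ) / 10)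
    (hν : 0 < ν) (hE : 0 < E) (hI : 0 < I) (hr : ν * I ≤ (1 / 250 : ℝ) ^ 2 * E ^ 2) :
    C * (ν * I / E ^ 2) ^ (θ / 2) ≤ 1 / 40 := by
  have hratio_pos : 0 < ν * I / E ^ 2 := by positivity
  have hratio_le : ν * I / E ^ 2 ≤ (1 / 250 : ℝ) ^ 2 := by
    rw [div_le_iff₀ (by positivity)]; exact hr
  have h1 : (ν * I / E ^ 2) ^ (θ / 2) ≤ ((1 / 250 : ℝ) ^ 2) ^ (θ / 2) :=
    Real.rpow_le_rpow hratio_pos.le hratio_le (by linarith)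
  have h2 : ((1 / 250 : ℝ) ^ 2) ^ (θ / 2) = (1 / 250 : ℝ) ^ θ := by
    rw [← Real.rpow_two, ← Real.rpow_mul (by norm_num : (0 : ℝ) ≤ 1 / 250),
      show (2 : ℝ) * (θ / 2) = θ by ring]
  calc C * (ν * I / E ^ 2) ^ (θ / 2) ≤ C * (1 / 250 : ℝ) ^ θ :=
        mul_le_mul_of_nonneg_left (h2 ▸ h1) hC
    _ ≤ 1 / 40 := clause_le_one_div_forty hθ hθ1 hcl

/-! ## §2 No closed-form orbit is in scope -/

/-- A field whose mean dissipation is at most the first-shell Poincaré value `4π² ν ⟨‖u‖²⟩` is NOT in scope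
(`4π² < 156.25`). Covers: single-shell steady states (laminar Kolmogorov/ABC/Beltrami), their Galilean and
swept variants `m + v(t)` (a constant adds energy, no dissipation), any single-shell periodic field. -/
theorem not_scope_of_poincare_saturating {ν E I : ℝ} (hν : 0 < ν) (hE : 0 < E)
    (hP : I ≤ 4 * Real.pi ^ 2 * (ν * E)) :
    ¬ ((1 / 20 : ℝ) * (E * Real.sqrt E) ≤ I ∧ ν * I ≤ (1 / 250 : ℝ) ^ 2 * E ^ 2) := by
  rintro ⟨hβ, hr⟩
  have h := taylor_floor_of_scope hν hE hβ hr
  have hpi : Real.pi ^ 2 < 16 := by nlinarith [Real.pi_lt_four, Real.pi_pos]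
  have hνE : 0 < ν * E := mul_pos hν hE
  nlinarith

/-- Green on the torus for a first-shell field: `‖∇v‖₂² = 4π² ‖v‖₂²` when `−Δv = 4π² v`. -/
theorem gradNormSq_eq_of_firstShell {v : 𝕋³ → E³} (hv : IsSmooth v)
    (hshell : ∀ x, laplacian v x = -((4 * Real.pi ^ 2) • v x)) :
    gradNormSq v = 4 * Real.pi ^ 2 * ∫ x, ‖v x‖ ^ 2 := by
  have hgreen := Literature.Analysis.FluidPDE.Torus.integral_inner_laplacian_eq_neg_sum hv hv
  have hlhs : ∫ x, ⟪laplacian v x, v x⟫_ℝ = -(4 * Real.pi ^ 2) * ∫ x, ‖v x‖ ^ 2 := by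
    rw [← integral_const_mul]
    refine integral_congr_ae (ae_of_all _ fun x => ?_)
    simp only [hshell x, inner_neg_left, inner_smul_left, real_inner_self_eq_norm_sq, RCLike.conj_to_real]
    ring
  have hrhs : ∑ i, ∫ x, ⟪partialDeriv i v x, partialDeriv i v x⟫_ℝ = gradNormSq v := by
    unfold gradNormSq
    rw [integral_finsetSum _ fun i _ => ((hv.partialDeriv i).norm_sq).integrable]
    refine Finset.sum_congr rfl fun i _ => integral_congr_ae (ae_of_all _ fun x => ?_)
    simp only [real_inner_self_eq_norm_sq]
  rw [hlhs, hrhs] at hgreen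
  linarith

/-- SINGLE-SHELL PERIODIC FIELDS ARE NEVER IN SCOPE: if every slice of a jointly smooth `τ`-periodic `u` is a
first-shell field then `meanDissipation ν u = 4π² ν · meanEnergy u`, incompatible with the scope. -/
theorem not_scope_of_firstShell_slices {ν τ : ℝ} {u : ℝ → 𝕋³ → E³} (hν : 0 < ν) (hτ : 0 < τ)
    (hu : IsSmoothSpaceTimeOn univ u) (hper : Periodic u τ)
    (hshell : ∀ t x, laplacian (u t) x = -((4 * Real.pi ^ 2) • u t x))
    (hE : 0 < meanEnergy u) :
    ¬ ((1 / 20 : ℝ) * (meanEnergy u * Real.sqrt (meanEnergy u)) ≤ meanDissipation ν u ∧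
        ν * meanDissipation ν u ≤ (1 / 250 : ℝ) ^ 2 * meanEnergy u ^ 2) := by
  refine not_scope_of_poincare_saturating hν hE (le_of_eq ?_)
  rw [meanDissipation_eq_period_mean hu hper hτ, meanEnergy_eq_period_mean hper hτ]
  have hslice : ∀ t, gradNormSq (u t) = 4 * Real.pi ^ 2 * ∫ x, ‖u t x‖ ^ 2 := fun t =>
    gradNormSq_eq_of_firstShell (hu.isSmooth_slice (mem_univ t)) (hshell t)
  simp_rw [hslice]
  rw [intervalIntegral.integral_const_mul]
  ring

/-! ## §3 Vacuity: empty scope proves the crux (the shape of the 2-D transfer) -/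

/-- If for every first-shell force the scope is EMPTY (no periodic classical orbit with `β ≥ 1/20`, `r ≤ 1/250`),
`HalvingCeiling` holds with `C = 0`, `θ = 1`. In 2-D this is exactly what Marchioro / Alexakis–Doering give; in 3-D it
would refute `EfficientAnchor` for every force (kill criterion (a) of the route). -/
theorem halvingCeiling_of_emptyScope
    (hempty : ∀ f : 𝕋³ → E³, IsSmooth f → IsDivFree f → HasZeroMean f →
      (∀ x, laplacian f x = -((4 * Real.pi ^ 2) • f x)) →
      ∀ (ν τ : ℝ) (u : ℝ → 𝕋³ → E³) (p : ℝ → 𝕋³ → ℝ), 0 < ν → 0 < τ → Periodic u τ →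
        IsClassicalNSSolutionOn univ ν (fun _ => f) u p → 0 < meanEnergy u →
        (1 / 20 : ℝ) * (meanEnergy u * Real.sqrt (meanEnergy u)) ≤ meanDissipation ν u →
        ¬ ν * meanDissipation ν u ≤ (1 / 250 : ℝ) ^ 2 * meanEnergy u ^ 2) :
    HalvingCeiling := by
  intro f hf hdiv hmean hshell
  refine ⟨0, 1, le_rfl, one_pos, le_rfl, by norm_num, ?_⟩
  intro ν τ u p hν hτ hper hsol hE hβ hr
  exact absurd hr (hempty f hf hdiv hmean hshell ν τ u p hν hτ hper hsol hE hβ)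

/-! ## §5a Strengthen: steady partners -/

/-- `SteadyHalvingCeiling`: the crux with the partner required to be a STEADY classical state of `NS_{ν/2}(f)`
(the loud-steady-states lever of other routes, transplanted). -/
def SteadyHalvingCeiling : Prop :=
  ∀ f : 𝕋³ → E³, IsSmooth f → IsDivFree f → HasZeroMean f →
    (∀ x, laplacian f x = -((4 * Real.pi ^ 2) • f x)) →
    ∃ C θ : ℝ, 0 ≤ C ∧ 0 < θ ∧ θ ≤ 1 ∧ C * (1 / 250 : ℝ) ^ θ ≤ (1 - (3 / 4 : ℝ) ^ θ) / 10 ∧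
      ∀ (ν τ : ℝ) (u : ℝ → 𝕋³ → E³) (p : ℝ → 𝕋³ → ℝ), 0 < ν → 0 < τ → Periodic u τ →
        IsClassicalNSSolutionOn univ ν (fun _ => f) u p → 0 < meanEnergy u →
        (1 / 20 : ℝ) * (meanEnergy u * Real.sqrt (meanEnergy u)) ≤ meanDissipation ν u →
        ν * meanDissipation ν u ≤ (1 / 250 : ℝ) ^ 2 * meanEnergy u ^ 2 →
        ∃ (v : 𝕋³ → E³) (q : 𝕋³ → ℝ),
          IsClassicalNSSolutionOn univ (ν / 2) (fun _ => f) (fun _ => v) (fun _ => q) ∧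
          |meanEnergy (fun _ => v) - meanEnergy u| ≤
            C * (ν * meanDissipation ν u / meanEnergy u ^ 2) ^ (θ / 2) * meanEnergy u ∧
          |meanDissipation (ν / 2) (fun _ => v) - meanDissipation ν u| ≤
            C * (ν * meanDissipation ν u / meanEnergy u ^ 2) ^ (θ / 2) * meanDissipation ν u

/-- Steady partners are periodic partners (any period): `SteadyHalvingCeiling → HalvingCeiling`. -/
theorem halvingCeiling_of_steady (h : SteadyHalvingCeiling) : HalvingCeiling := by
  intro f hf hdiv hmean hshell
  obtain ⟨C, θ, hC, hθ, hθ1, hcl, hstep⟩ := h f hf hdiv hmean hshell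
  refine ⟨C, θ, hC, hθ, hθ1, hcl, ?_⟩
  intro ν τ u p hν hτ hper hsol hE hβ hr
  obtain ⟨v, q, hv, hEv, hIv⟩ := hstep ν τ u p hν hτ hper hsol hE hβ hr
  exact ⟨1, fun _ => v, fun _ => q, one_pos, fun _ => rfl, hv, hEv, hIv⟩


/-! ## §4 Transfer in statement space — Reynolds similarity: the Grashof (unit-viscosity) form

The parabolic rescaling `(u,p)(t,x) ↦ (λu, λ²p)(λt, x)` maps `τ`-periodic classical orbits of `NS_ν(F)` to
`τ/λ`-periodic orbits of `NS_{λν}(λ²F)` with `Ē ↦ λ²Ē`, `Ī ↦ λ³Ī`; the scope numbers `β = Ī/Ē^{3/2}`,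
`r² = νĪ/Ē²` and the modulus `ρ = (νĪ/Ē²)^{θ/2}` are INVARIANT. Hence the crux has an equivalent form at
viscosity ONE in which the only parameter is the force amplitude (Grashof number): halving `ν` ≡ multiplying
the force by `4`, with budgets following the K41 similarity law `Ē ∝ G`, `Ī ∝ G^{3/2}` up to `Cρ`. -/

/-- Parabolic rescaling packaged: from a `τ`-periodic classical orbit of `NS_ν(F)` to a `τ/λ`-periodic orbit of
`NS_{λν}(λ²F)` with `Ē ↦ λ²Ē`, `Ī ↦ λ³Ī` (`λ > 0`; landed lemmas of `Theorems/DenseLoudDesignerForces/Negative/Scaling`). -/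
theorem rescale_orbit {ν lam τ : ℝ} {F : 𝕋³ → E³} {u : ℝ → 𝕋³ → E³} {p : ℝ → 𝕋³ → ℝ}
    (hsol : IsClassicalNSSolutionOn univ ν (fun _ => F) u p) (hper : Periodic u τ) (hτ : 0 < τ)
    (hl : 0 < lam) :
    ∃ (u₁ : ℝ → 𝕋³ → E³) (p₁ : ℝ → 𝕋³ → ℝ),
      IsClassicalNSSolutionOn univ (lam * ν) (fun _ => lam ^ 2 • F) u₁ p₁ ∧ Periodic u₁ (τ / lam) ∧
      meanEnergy u₁ = lam ^ 2 * meanEnergy u ∧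
      meanDissipation (lam * ν) u₁ = lam ^ 3 * meanDissipation ν u :=
  ⟨_, _, Summit.AnomalousDissipation.AnomalousDissipation.Theorems.DenseLoudDesignerForces.Negative.timeRescale
    hsol lam, periodic_timeRescale hper hl.ne', meanEnergy_timeRescale hper hτ hl,
    meanDissipation_timeRescale hsol.smooth_velocity hper hτ hl⟩

/-- `√(λ²E) = λ√E` for `λ ≥ 0`. -/
theorem sqrt_sq_mul {lam E : ℝ} (hl : 0 ≤ lam) : Real.sqrt (lam ^ 2 * E) = lam * Real.sqrt E := by
  rw [Real.sqrt_mul (sq_nonneg lam), Real.sqrt_sq hl]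

/-- `β` is scale invariant: the drag floor transfers both ways under `(E, I) ↦ (λ²E, λ³I)`. -/
theorem beta_rescale_iff {lam E I : ℝ} (hl : 0 < lam) :
    (1 / 20 : ℝ) * (lam ^ 2 * E * Real.sqrt (lam ^ 2 * E)) ≤ lam ^ 3 * I ↔
      (1 / 20 : ℝ) * (E * Real.sqrt E) ≤ I := by
  rw [sqrt_sq_mul hl.le]
  have key : (1 / 20 : ℝ) * (lam ^ 2 * E * (lam * Real.sqrt E)) = lam ^ 3 * ((1 / 20 : ℝ) * (E * Real.sqrt E)) := by
    ring
  rw [key]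
  have h3 : 0 < lam ^ 3 := pow_pos hl 3
  constructor
  · intro h; exact le_of_mul_le_mul_left h h3
  · intro h; exact mul_le_mul_of_nonneg_left h h3.le

/-- `r²` is scale invariant: the Reynolds ceiling transfers both ways under `(ν, E, I) ↦ (λν, λ²E, λ³I)`. -/
theorem reynolds_rescale_iff {lam ν E I : ℝ} (hl : 0 < lam) :
    lam * ν * (lam ^ 3 * I) ≤ (1 / 250 : ℝ) ^ 2 * (lam ^ 2 * E) ^ 2 ↔ ν * I ≤ (1 / 250 : ℝ) ^ 2 * E ^ 2 := by
  have key1 : lam * ν * (lam ^ 3 * I) = lam ^ 4 * (ν * I) := by ring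
  have key2 : (1 / 250 : ℝ) ^ 2 * (lam ^ 2 * E) ^ 2 = lam ^ 4 * ((1 / 250 : ℝ) ^ 2 * E ^ 2) := by ring
  rw [key1, key2]
  have h4 : 0 < lam ^ 4 := pow_pos hl 4
  constructor
  · intro h; exact le_of_mul_le_mul_left h h4
  · intro h; exact mul_le_mul_of_nonneg_left h h4.le

/-- The modulus base `νĪ/Ē²` is scale invariant. -/
theorem ratio_rescale {lam ν E I : ℝ} (hl : 0 < lam) (hE : 0 < E) :
    lam * ν * (lam ^ 3 * I) / (lam ^ 2 * E) ^ 2 = ν * I / E ^ 2 := by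
  have hl0 : lam ≠ 0 := hl.ne'
  have hE0 : E ≠ 0 := hE.ne'
  rw [div_eq_div_iff (by positivity) (by positivity)]
  ring

/-- `GrashofCeiling` — THE CRUX AT UNIT VISCOSITY. For every first-shell force `f` there are `(C, θ)` in the
pinned clause such that for every amplitude `s > 0`, every periodic classical orbit `U` of `NS₁(s•f)` in the scope
`Ē > 0`, `β ≥ 1/20`, `Ī ≤ (1/250)² Ē²` has a partner periodic classical orbit `U'` of `NS₁((4s)•f)` (force
QUADRUPLED, viscosity unchanged) with `|Ē' − 4Ē| ≤ 4CρĒ` and `|Ī' − 8Ī| ≤ 8CρĪ`, `ρ = (Ī/Ē²)^{θ/2}`: Reynolds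
similarity `Ē ∝ G`, `Ī ∝ G^{3/2}` across one factor-4 step in the Grashof number. -/
def GrashofCeiling : Prop :=
  ∀ f : 𝕋³ → E³, IsSmooth f → IsDivFree f → HasZeroMean f →
    (∀ x, laplacian f x = -((4 * Real.pi ^ 2) • f x)) →
    ∃ C θ : ℝ, 0 ≤ C ∧ 0 < θ ∧ θ ≤ 1 ∧ C * (1 / 250 : ℝ) ^ θ ≤ (1 - (3 / 4 : ℝ) ^ θ) / 10 ∧
      ∀ (s τ : ℝ) (U : ℝ → 𝕋³ → E³) (P : ℝ → 𝕋³ → ℝ), 0 < s → 0 < τ → Periodic U τ →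
        IsClassicalNSSolutionOn univ 1 (fun _ => s • f) U P → 0 < meanEnergy U →
        (1 / 20 : ℝ) * (meanEnergy U * Real.sqrt (meanEnergy U)) ≤ meanDissipation 1 U →
        meanDissipation 1 U ≤ (1 / 250 : ℝ) ^ 2 * meanEnergy U ^ 2 →
        ∃ (τ' : ℝ) (U' : ℝ → 𝕋³ → E³) (P' : ℝ → 𝕋³ → ℝ), 0 < τ' ∧ Periodic U' τ' ∧
          IsClassicalNSSolutionOn univ 1 (fun _ => (4 * s) • f) U' P' ∧
          |meanEnergy U' - 4 * meanEnergy U| ≤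
            4 * (C * (meanDissipation 1 U / meanEnergy U ^ 2) ^ (θ / 2) * meanEnergy U) ∧
          |meanDissipation 1 U' - 8 * meanDissipation 1 U| ≤
            8 * (C * (meanDissipation 1 U / meanEnergy U ^ 2) ^ (θ / 2) * meanDissipation 1 U)

/-- `HalvingCeiling → GrashofCeiling` (rescale an orbit of `NS₁(s f)` to viscosity `s^{-1/2}` and force `f`,
halve, rescale the partner back to viscosity one). -/
theorem grashofCeiling_of_halvingCeiling (h : HalvingCeiling) : GrashofCeiling := by
  intro f hf hdiv hmean hshell
  obtain ⟨C, θ, hC, hθ, hθ1, hcl, hstep⟩ := h f hf hdiv hmean hshell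
  refine ⟨C, θ, hC, hθ, hθ1, hcl, ?_⟩
  intro s τ U P hs hτ hper hsol hE hβ hr
  -- rescale to viscosity `λ = 1/√s`, where the force `λ²·(s•f)` is `f`
  have hsq : Real.sqrt s ^ 2 = s := Real.sq_sqrt hs.le
  have hspos : 0 < Real.sqrt s := Real.sqrt_pos.2 hs
  set lam : ℝ := (Real.sqrt s)⁻¹ with hlam
  have hl : 0 < lam := inv_pos.2 hspos
  have hl0 : lam ≠ 0 := hl.ne'
  have hl2s : lam ^ 2 * s = 1 := by
    rw [hlam, inv_pow, hsq]; exact inv_mul_cancel₀ hs.ne'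
  obtain ⟨u, p, hsolu, hperu, hEu, hIu⟩ := rescale_orbit hsol hper hτ hl
  have hforce : (fun _ : ℝ => lam ^ 2 • (s • f)) = fun _ => f := by
    funext t; rw [smul_smul, hl2s, one_smul]
  rw [hforce, mul_one] at hsolu
  rw [mul_one] at hIu
  -- the rescaled orbit is in scope at viscosity `λ`
  have hE' : 0 < meanEnergy u := by rw [hEu]; positivity
  have hβ' : (1 / 20 : ℝ) * (meanEnergy u * Real.sqrt (meanEnergy u)) ≤ meanDissipation lam u := by
    rw [hEu, hIu]; exact (beta_rescale_iff hl).2 hβ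
  have hr' : lam * meanDissipation lam u ≤ (1 / 250 : ℝ) ^ 2 * meanEnergy u ^ 2 := by
    rw [hEu, hIu]
    have := (reynolds_rescale_iff (ν := 1) (E := meanEnergy U) (I := meanDissipation 1 U) hl).2
      (by simpa using hr)
    simpa using this
  -- halve
  obtain ⟨τ', u', p', hτ', hper', hsol', hE'', hI''⟩ :=
    hstep lam (τ / lam) u p hl (div_pos hτ hl) hperu hsolu hE' hβ' hr'
  rw [hEu, hIu] at hE'' hI''
  have hρ : lam * (lam ^ 3 * meanDissipation 1 U) / (lam ^ 2 * meanEnergy U) ^ 2 =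
      meanDissipation 1 U / meanEnergy U ^ 2 := by
    have := ratio_rescale (ν := 1) (E := meanEnergy U) (I := meanDissipation 1 U) hl hE
    simpa using this
  rw [hρ] at hE'' hI''
  -- rescale the partner back to viscosity one with `μ = 2/λ` (force `μ² f = 4s f`)
  have hμ : 0 < 2 / lam := by positivity
  obtain ⟨U', P', hsolU', hperU', hEU', hIU'⟩ := rescale_orbit hsol' hper' hτ' hμ
  have hμν : 2 / lam * (lam / 2) = 1 := by field_simp
  have hμ2 : (2 / lam) ^ 2 = 4 * s := by
    rw [div_pow, hlam, inv_pow, hsq]; field_simp; norm_num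
  rw [hμν, hμ2] at hsolU'
  rw [hμν] at hIU'
  refine ⟨τ' / (2 / lam), U', P', div_pos hτ' hμ, hperU', hsolU', ?_, ?_⟩
  · -- energy: `|μ²Ē(u') − 4Ē(U)| = μ²|Ē(u') − λ²Ē(U)| ≤ μ²·Cρ·λ²Ē(U) = 4CρĒ(U)`
    set ρ : ℝ := (meanDissipation 1 U / meanEnergy U ^ 2) ^ (θ / 2) with hρdef
    clear_value ρ
    have h4 : (2 / lam) ^ 2 * lam ^ 2 = 4 := by field_simp; norm_num
    have eq1 : meanEnergy U' - 4 * meanEnergy U =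
        (2 / lam) ^ 2 * (meanEnergy u' - lam ^ 2 * meanEnergy U) := by
      rw [hEU', mul_sub, ← mul_assoc, h4]
    rw [eq1, abs_mul, abs_of_pos (pow_pos hμ 2)]
    calc (2 / lam) ^ 2 * |meanEnergy u' - lam ^ 2 * meanEnergy U|
        ≤ (2 / lam) ^ 2 * (C * ρ * (lam ^ 2 * meanEnergy U)) :=
          mul_le_mul_of_nonneg_left hE'' (pow_pos hμ 2).le
      _ = 4 * (C * ρ * meanEnergy U) := by rw [← h4]; ring
  · -- dissipation: `|μ³Ī(u') − 8Ī(U)| = μ³|Ī(u') − λ³Ī(U)| ≤ μ³·Cρ·λ³Ī(U) = 8CρĪ(U)`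
    set ρ : ℝ := (meanDissipation 1 U / meanEnergy U ^ 2) ^ (θ / 2) with hρdef
    clear_value ρ
    have h8 : (2 / lam) ^ 3 * lam ^ 3 = 8 := by field_simp; norm_num
    have eq1 : meanDissipation 1 U' - 8 * meanDissipation 1 U =
        (2 / lam) ^ 3 * (meanDissipation (lam / 2) u' - lam ^ 3 * meanDissipation 1 U) := by
      rw [hIU', mul_sub, ← mul_assoc, h8]
    rw [eq1, abs_mul, abs_of_pos (pow_pos hμ 3)]
    calc (2 / lam) ^ 3 * |meanDissipation (lam / 2) u' - lam ^ 3 * meanDissipation 1 U|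
        ≤ (2 / lam) ^ 3 * (C * ρ * (lam ^ 3 * meanDissipation 1 U)) :=
          mul_le_mul_of_nonneg_left hI'' (pow_pos hμ 3).le
      _ = 8 * (C * ρ * meanDissipation 1 U) := by rw [← h8]; ring

/-- `GrashofCeiling → HalvingCeiling` (rescale an orbit of `NS_ν(f)` to viscosity one and force `ν⁻²f`,
quadruple the force, rescale the partner back with `μ = ν/2`). -/
theorem halvingCeiling_of_grashofCeiling (h : GrashofCeiling) : HalvingCeiling := by
  intro f hf hdiv hmean hshell
  obtain ⟨C, θ, hC, hθ, hθ1, hcl, hstep⟩ := h f hf hdiv hmean hshell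
  refine ⟨C, θ, hC, hθ, hθ1, hcl, ?_⟩
  intro ν τ u p hν hτ hper hsol hE hβ hr
  have hν0 : ν ≠ 0 := hν.ne'
  -- rescale to viscosity one with `λ = 1/ν`; the force becomes `λ² f`
  set lam : ℝ := ν⁻¹ with hlam
  have hl : 0 < lam := inv_pos.2 hν
  have hl0 : lam ≠ 0 := hl.ne'
  have hlν : lam * ν = 1 := by rw [hlam]; field_simp
  obtain ⟨U, P, hsolU, hperU, hEU, hIU⟩ := rescale_orbit hsol hper hτ hl
  rw [hlν] at hsolU hIU
  -- scope at viscosity one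
  have hE' : 0 < meanEnergy U := by rw [hEU]; positivity
  have hβ' : (1 / 20 : ℝ) * (meanEnergy U * Real.sqrt (meanEnergy U)) ≤ meanDissipation 1 U := by
    rw [hEU, hIU]; exact (beta_rescale_iff hl).2 hβ
  have hr' : meanDissipation 1 U ≤ (1 / 250 : ℝ) ^ 2 * meanEnergy U ^ 2 := by
    rw [hEU, hIU]
    have := (reynolds_rescale_iff (ν := ν) (E := meanEnergy u) (I := meanDissipation ν u) hl).2 hr
    rwa [hlν, one_mul] at this
  -- quadruple the force
  obtain ⟨τ', U', P', hτ', hper', hsol', hE'', hI''⟩ :=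
    hstep (lam ^ 2) (τ / lam) U P (by positivity) (div_pos hτ hl) hperU hsolU hE' hβ' hr'
  rw [hEU, hIU] at hE'' hI''
  have hρ : lam ^ 3 * meanDissipation ν u / (lam ^ 2 * meanEnergy u) ^ 2 =
      ν * meanDissipation ν u / meanEnergy u ^ 2 := by
    have := ratio_rescale (ν := ν) (E := meanEnergy u) (I := meanDissipation ν u) hl hE
    rwa [hlν, one_mul] at this
  rw [hρ] at hE'' hI''
  -- rescale the partner back with `μ = ν/2`: viscosity `ν/2`, force `μ²·(4λ²)·f = f`
  have hμ : 0 < ν / 2 := by positivity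
  obtain ⟨u', p', hsolu', hperu', hEu', hIu'⟩ := rescale_orbit hsol' hper' hτ' hμ
  have hforce : (fun _ : ℝ => (ν / 2) ^ 2 • ((4 * lam ^ 2) • f)) = fun _ => f := by
    funext t
    rw [smul_smul]
    have : (ν / 2) ^ 2 * (4 * lam ^ 2) = 1 := by rw [hlam]; field_simp; ring
    rw [this, one_smul]
  rw [hforce, mul_one] at hsolu'
  rw [mul_one] at hIu'
  refine ⟨τ' / (ν / 2), u', p', div_pos hτ' hμ, hperu', hsolu', ?_, ?_⟩
  · set ρ : ℝ := (ν * meanDissipation ν u / meanEnergy u ^ 2) ^ (θ / 2) with hρdef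
    clear_value ρ
    have eq1 : meanEnergy u' - meanEnergy u =
        (ν / 2) ^ 2 * (meanEnergy U' - 4 * (lam ^ 2 * meanEnergy u)) := by
      rw [hEu', mul_sub]
      have : (ν / 2) ^ 2 * (4 * (lam ^ 2 * meanEnergy u)) = meanEnergy u := by
        rw [hlam]; field_simp; ring
      rw [this]
    rw [eq1, abs_mul, abs_of_pos (pow_pos hμ 2)]
    calc (ν / 2) ^ 2 * |meanEnergy U' - 4 * (lam ^ 2 * meanEnergy u)|
        ≤ (ν / 2) ^ 2 * (4 * (C * ρ * (lam ^ 2 * meanEnergy u))) :=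
          mul_le_mul_of_nonneg_left hE'' (pow_pos hμ 2).le
      _ = C * ρ * meanEnergy u := by rw [hlam]; field_simp; ring
  · set ρ : ℝ := (ν * meanDissipation ν u / meanEnergy u ^ 2) ^ (θ / 2) with hρdef
    clear_value ρ
    have eq1 : meanDissipation (ν / 2) u' - meanDissipation ν u =
        (ν / 2) ^ 3 * (meanDissipation 1 U' - 8 * (lam ^ 3 * meanDissipation ν u)) := by
      rw [hIu', mul_sub]
      have : (ν / 2) ^ 3 * (8 * (lam ^ 3 * meanDissipation ν u)) = meanDissipation ν u := by
        rw [hlam]; field_simp; ring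
      rw [this]
    rw [eq1, abs_mul, abs_of_pos (pow_pos hμ 3)]
    calc (ν / 2) ^ 3 * |meanDissipation 1 U' - 8 * (lam ^ 3 * meanDissipation ν u)|
        ≤ (ν / 2) ^ 3 * (8 * (C * ρ * (lam ^ 3 * meanDissipation ν u))) :=
          mul_le_mul_of_nonneg_left hI'' (pow_pos hμ 3).le
      _ = C * ρ * meanDissipation ν u := by rw [hlam]; field_simp; ring

/-- **REYNOLDS SIMILARITY (typed transfer T0).** The crux is EQUIVALENT to its unit-viscosity / Grashof form:
halving the viscosity at fixed force ≡ quadrupling the force at fixed viscosity. -/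
theorem halvingCeiling_iff_grashofCeiling : HalvingCeiling ↔ GrashofCeiling :=
  ⟨grashofCeiling_of_halvingCeiling, halvingCeiling_of_grashofCeiling⟩

/-! ## §5b Strengthen: the Grashof-LOCAL log-Lipschitz response (signature; STRONGER than the crux) -/

/-- `LocalLogLipschitzResponse δ₀`: at unit viscosity, along the force ray `λ ↦ (λs)•f`, every in-scope periodic
orbit at amplitude `s` has, for EVERY `λ ∈ [1, 1+δ₀]`, a partner periodic orbit at amplitude `λs` whose
similarity-normalised budgets `(Ē'/λ, Ī'/λ^{3/2})` moved by at most `K ρ log λ` (relative) — the differential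
(linear-response) form of Reynolds similarity. With `δ₀ ≥ 3` it contains `λ = 4`, i.e. the Grashof form itself
(`grashofCeiling_of_logLipschitz_four`); with small `δ₀` it implies it by composing `⌈log 4/log(1+δ₀)⌉` steps
(Lipschitz moduli compose; Hölder ones do not) — either way it is a STRENGTHENING, recorded as S-B in the census. -/
def LocalLogLipschitzResponse (δ₀ : ℝ) : Prop :=
  ∀ f : 𝕋³ → E³, IsSmooth f → IsDivFree f → HasZeroMean f →
    (∀ x, laplacian f x = -((4 * Real.pi ^ 2) • f x)) →
    ∃ K θ : ℝ, 0 ≤ K ∧ 0 < θ ∧ θ ≤ 1 ∧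
      K * Real.log 4 * (1 / 250 : ℝ) ^ θ ≤ (1 - (3 / 4 : ℝ) ^ θ) / 10 ∧
      ∀ (s lam τ : ℝ) (U : ℝ → 𝕋³ → E³) (P : ℝ → 𝕋³ → ℝ), 0 < s → 1 ≤ lam → lam ≤ 1 + δ₀ →
        0 < τ → Periodic U τ →
        IsClassicalNSSolutionOn univ 1 (fun _ => s • f) U P → 0 < meanEnergy U →
        (1 / 20 : ℝ) * (meanEnergy U * Real.sqrt (meanEnergy U)) ≤ meanDissipation 1 U →
        meanDissipation 1 U ≤ (1 / 250 : ℝ) ^ 2 * meanEnergy U ^ 2 →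
        ∃ (τ' : ℝ) (U' : ℝ → 𝕋³ → E³) (P' : ℝ → 𝕋³ → ℝ), 0 < τ' ∧ Periodic U' τ' ∧
          IsClassicalNSSolutionOn univ 1 (fun _ => (lam * s) • f) U' P' ∧
          |meanEnergy U' - lam * meanEnergy U| ≤
            lam * (K * Real.log lam * (meanDissipation 1 U / meanEnergy U ^ 2) ^ (θ / 2) * meanEnergy U) ∧
          |meanDissipation 1 U' - lam * Real.sqrt lam * meanDissipation 1 U| ≤
            lam * Real.sqrt lam *
              (K * Real.log lam * (meanDissipation 1 U / meanEnergy U ^ 2) ^ (θ / 2) * meanDissipation 1 U)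

/-- With `δ₀ = 3` the local statement contains the factor-4 step: `LocalLogLipschitzResponse 3 → GrashofCeiling`
(so S-B is at least as strong as the crux, by `halvingCeiling_iff_grashofCeiling`). -/
theorem grashofCeiling_of_logLipschitz_four (h : LocalLogLipschitzResponse 3) : GrashofCeiling := by
  intro f hf hdiv hmean hshell
  obtain ⟨K, θ, hK, hθ, hθ1, hcl, hstep⟩ := h f hf hdiv hmean hshell
  refine ⟨K * Real.log 4, θ, mul_nonneg hK (Real.log_nonneg (by norm_num)), hθ, hθ1, hcl, ?_⟩
  intro s τ U P hs hτ hper hsol hE hβ hr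
  obtain ⟨τ', U', P', hτ', hper', hsol', hE', hI'⟩ :=
    hstep s 4 τ U P hs (by norm_num) (by norm_num) hτ hper hsol hE hβ hr
  have hs4 : Real.sqrt 4 = 2 := by
    rw [show (4 : ℝ) = 2 ^ 2 by norm_num, Real.sqrt_sq (by norm_num : (0 : ℝ) ≤ 2)]
  rw [hs4] at hI'
  refine ⟨τ', U', P', hτ', hper', hsol', ?_, ?_⟩
  · calc |meanEnergy U' - 4 * meanEnergy U|
        ≤ 4 * (K * Real.log 4 * (meanDissipation 1 U / meanEnergy U ^ 2) ^ (θ / 2) * meanEnergy U) := hE'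
      _ = 4 * (K * Real.log 4 * (meanDissipation 1 U / meanEnergy U ^ 2) ^ (θ / 2) * meanEnergy U) := rfl
  · calc |meanDissipation 1 U' - 8 * meanDissipation 1 U|
        = |meanDissipation 1 U' - 4 * 2 * meanDissipation 1 U| := by norm_num
      _ ≤ 4 * 2 * (K * Real.log 4 * (meanDissipation 1 U / meanEnergy U ^ 2) ^ (θ / 2) *
            meanDissipation 1 U) := hI'
      _ = 8 * (K * Real.log 4 * (meanDissipation 1 U / meanEnergy U ^ 2) ^ (θ / 2) *
            meanDissipation 1 U) := by norm_num

/-! ## §6 The halving defect in budget currency: it carries exactly half the dissipation -/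

/-- For a `τ`-periodic classical orbit `u` of `NS_ν(f)` (steady smooth `f`), the period-mean power of the halving
defect force `e = (ν/2)Δu` — the force by which `u` fails to solve `NS_{ν/2}(f)` (route item `HalvingDefect`:
`u` solves `NS_{ν/2}(f + e)`) — is EXACTLY `−Ī/2`:
`τ⁻¹∫₀^τ∫⟪(ν/2)Δu, u⟫ = −(1/2)·meanDissipation ν u`. In budget currency the halving is a fifty-per-cent kick
(it withdraws half of the dissipation budget), whatever norm makes `e` look small (relative size `r → 0` in
`L²_tḢ⁻¹`, the route's dictionary); the crux asserts an `O(r^θ)` RESPONSE of `(Ē, Ī)` to an `O(1)` perturbation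
of the enstrophy balance — a non-perturbative claim (Transfer §T-A/T-B of the census). -/
theorem defectPower_eq_neg_half_meanDissipation {ν τ : ℝ} {f : 𝕋³ → E³} {u : ℝ → 𝕋³ → E³}
    {p : ℝ → 𝕋³ → ℝ} (hsol : IsClassicalNSSolutionOn univ ν (fun _ => f) u p) (hper : Periodic u τ)
    (hτ : 0 < τ) :
    τ⁻¹ * ∫ t in (0 : ℝ)..τ, ∫ x, ⟪(ν / 2) • laplacian (u t) x, u t x⟫_ℝ =
      -(1 / 2) * meanDissipation ν u := by
  rw [meanDissipation_eq_period_mean hsol.smooth_velocity hper hτ]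
  have hslice : ∀ t, ∫ x, ⟪(ν / 2) • laplacian (u t) x, u t x⟫_ℝ = -(ν / 2) * gradNormSq (u t) := by
    intro t
    have hut : IsSmooth (u t) := hsol.smooth_velocity.isSmooth_slice (mem_univ t)
    have hgreen := Literature.Analysis.FluidPDE.Torus.integral_inner_laplacian_eq_neg_sum hut hut
    have hrhs : ∑ i, ∫ x, ⟪partialDeriv i (u t) x, partialDeriv i (u t) x⟫_ℝ = gradNormSq (u t) := by
      unfold gradNormSq
      rw [integral_finsetSum _ fun i _ => ((hut.partialDeriv i).norm_sq).integrable]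
      refine Finset.sum_congr rfl fun i _ => integral_congr_ae (ae_of_all _ fun x => ?_)
      simp only [real_inner_self_eq_norm_sq]
    simp_rw [real_inner_smul_left]
    rw [integral_const_mul, hgreen, hrhs]
    ring
  simp_rw [hslice]
  rw [intervalIntegral.integral_const_mul]
  ring

/-- Corollary in the route's own currency: the defect's mean power has modulus `Ī/2`, i.e. relative to the
dissipation budget it is never small — for EVERY in-scope orbit, at EVERY Reynolds number. -/
theorem abs_defectPower_eq_half_meanDissipation {ν τ : ℝ} {f : 𝕋³ → E³} {u : ℝ → 𝕋³ → E³}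
    {p : ℝ → 𝕋³ → ℝ} (hsol : IsClassicalNSSolutionOn univ ν (fun _ => f) u p) (hper : Periodic u τ)
    (hτ : 0 < τ) (hI : 0 ≤ meanDissipation ν u) :
    |τ⁻¹ * ∫ t in (0 : ℝ)..τ, ∫ x, ⟪(ν / 2) • laplacian (u t) x, u t x⟫_ℝ| =
      (1 / 2) * meanDissipation ν u := by
  rw [defectPower_eq_neg_half_meanDissipation hsol hper hτ, abs_of_nonpos (by nlinarith)]
  ring

end Summit.AnomalousDissipation.AnomalousDissipation.Cruxes.HalvingCeiling.Census

end
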